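import Literature.IUT.HodgeTheaters.TemperedCoveringsProp24iiObservation
import Literature.AnabelianGeometry.SemiGraphs.ArithMaximalCompact
import HarnessLib

/-!
# [IUTchI] Prop. 2.4 (ii), "this observation": the input (A1-arith) keyed on [SemiAnbd] Thm. 5.4 (i) AS TYPED
# by abc-iut-L3 (`ArithMaximalCompactStatementI`, `IsArithAmple`)

Mochizuki, *Inter-universal Teichmüller theory I*, kurims manuscript (May 2020), §2, proof of Prop. 2.4 (ii),
p. 50 l. 52 – p. 51 l. 13 ("instead of applying [SemiAnbd], Theorem 3.7, (iii), we apply its *arithmetic analogue*,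
namely, [SemiAnbd], Theorem 5.4, (ii); [SemiAnbd], Example 5.6") [cite: Mochizuki2012, Prop 2.4(ii) pp.50-51]
(D-0012 claim key; nothing of the series is asserted here), over Mochizuki, *Semi-graphs of anabelioids*, Publ. RIMS
**42** (2006), Def. 5.3 (i)(iii) p. 65 and Thm. 5.4 (i) p. 66 ("Every arithmetically ample compact subgroup of
`π₁^temp(𝒢)` is contained in at least one verticial subgroup") [cite: MochizukiSemiAnbd2006, Thm 5.4(i) p.66].
Pages: [IUTchI] = kurims preprint render IUTchI-kurims-url-690e7b3c6199; [SemiAnbd] = kurims render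
SemiAnbd-kurims-url-f33ace170ff4 (lit/SOURCES.md §0/§11).

PROOF-ONLY sequel (abc-iut-L5-t11; no definitions, no new `Prop` fact) of `TemperedCoveringsProp24iiObservation.lean`:
there (OBS) `Prop24QTower.LevelObservation` was derived per level from (A1-arith) + (A3-arith) in coset coordinates.
HERE the per-level input (A1-arith)_j is keyed on abc-iut-L3's §5 vocabulary (`ArithMaximalCompact.lean`,
abc-iut-L3): a `DecompositionData (Π^tp_j) V B` of the level-`j` arithmetic semi-graph of anabelioids (chosen vertex /
branch decomposition groups inside the tempered level quotient `Π^tp_j := Π^tp_X/Ker(J ↠ Π^tp_{𝔾*_J})`), an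
augmentation `augTp j : Π^tp_j → Π_A` and L3's typed conclusion of Thm. 5.4 (i)
`ArithMaximalCompactStatementI (Dd j) (augTp j)` ("every arithmetically ample compact subgroup lies in a verticial
subgroup"), plus the per-level pull-back law `hK` (the `ι`-preimage of a `Π̂_j`-conjugate of the image of `Λ` that lies
in `ι(Π^tp_j)` is compact and arithmetically ample — (A0) at the level quotient and the compatibility of the
augmentations with "open image in `G_k`").  Results: `Prop24QTower.levelObservation_of_arithStatementI` and, at the
genuine 𝔛-datum over `P : SpecialFibreTower.PiData`, `OfSpecialFibre.prop24ii_ofPiData_of_arithStatementI`.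
DISCHARGE ROUTE: `ArithMaximalCompactStatementI` is PROVED by abc-iut-L3 for the produced data of a chart at finite
graphs (`arithMaximalCompactStatementI_and_II_ofChartAt`, `…_of_finiteLevelData`), so (A1-arith)_j becomes a theorem
the moment the level-quotient pair is identified with L3's produced arithmetic chart data (L3-side bridge); what then
remains of "this observation" is (A3-arith) ([AbsTopII] Prop 1.3 (iv) / [NodNon] Prop 3.9 (i)) and `hK`.
CONDITIONAL, as labelled; typed ≠ discharged; `P` is origin data inhabited at model towers only; nothing here asserts
that abc is proved or refuted, and nothing here bears on [IUTchIII] Cor. 3.12.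
-/

noncomputable section

namespace Literature.IUT.HodgeTheaters

open _root_.Topology
open scoped Pointwise
open Literature.AnabelianGeometry.SemiGraphs

universe u

namespace StableCurveTemperedData

namespace Prop24QTower

variable {D : StableCurveTemperedData.{u}} (T : D.Prop24QTower)

/-- The image under a homomorphism of a conjugate `g K g⁻¹` (abc-iut-L3's `conjSubgroup`) lies in the conjugate by the
image of `g` of the image of `K`. [cite: MochizukiSemiAnbd2006, §0 p.5] -/
private theorem map_conjSubgroup_le {G H : Type*} [Group G] [Group H] (f : G →* H) (g : G) (K : Subgroup G) :
    (conjSubgroup g K).map f ≤ MulAut.conj (f g) • K.map f := by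
  rintro _ ⟨_, ⟨k, hk, rfl⟩, rfl⟩
  rw [Subgroup.mem_smul_pointwise_iff_exists]
  refine ⟨f k, ⟨k, hk, rfl⟩, ?_⟩
  simp only [MulEquiv.coe_toMonoidHom, MulAut.conj_apply, map_mul, map_inv, MulAut.smul_def]

/-- **(OBS) `LevelObservation` from [SemiAnbd] Thm. 5.4 (i) AS TYPED by abc-iut-L3 at every level quotient.**  Per
level `j`: a `DecompositionData` of the arithmetic level graph inside `Π^tp_j` with augmentation `augTp j`, L3's
`ArithMaximalCompactStatementI (Dd j) (augTp j)` (`hI`), the pull-back law `hK` (compact + arithmetically ample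
preimages of the conjugates of the image of `Λ` lying in `ι(Π^tp_j)`), node data with tempered branch conjugators,
and (A3-arith)_j for the verticial subgroups `ι(Π^tp_{𝔊,v})` ([AbsTopII] Prop 1.3 (iv) / [NodNon] Prop 3.9 (i):
"coincide, are adjacent, or admit a common adjacent vertex"). ([IUTchI] Prop 2.4(ii) pp.50-51) [claim: Mochizuki2012, status: disputed] -/
theorem levelObservation_of_arithStatementI
    {V B : T.I → Type*} (Dd : ∀ j, DecompositionData (T.Q j).Tp (V j) (B j))
    {PA : T.I → Type*} [∀ j, Group (PA j)] [∀ j, TopologicalSpace (PA j)]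
    (augTp : ∀ j, (T.Q j).Tp →* PA j)
    (hI : ∀ j, ArithMaximalCompactStatementI (Dd j) (augTp j))
    (hK : ∀ (j : T.I) (Λ : Subgroup D.PiTp), IsCompact (Λ : Set D.PiTp) → Λ ≠ ⊥ →
      IsOpen (Λ.map D.prTp : Set D.Gk) → ∀ γ : (T.Q j).Hat,
        MulAut.conj γ • Λ.map ((T.qhat j).comp D.ιX) ≤ (T.Q j).ι.range →
          IsCompact ((((MulAut.conj γ • Λ.map ((T.qhat j).comp D.ιX)).comap (T.Q j).ι :
              Subgroup (T.Q j).Tp)) : Set (T.Q j).Tp) ∧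
          IsArithAmple (augTp j) ((MulAut.conj γ • Λ.map ((T.qhat j).comp D.ιX)).comap (T.Q j).ι))
    {E : T.I → Type*} (src tgt : ∀ j, E j → V j) (c₁ c₂ : ∀ j, E j → (T.Q j).Tp)
    (hA3 : ∀ (j : T.I) (Λ : Subgroup D.PiTp), IsCompact (Λ : Set D.PiTp) → Λ ≠ ⊥ →
      IsOpen (Λ.map D.prTp : Set D.Gk) → ∀ (v w : V j) (g h γ : (T.Q j).Hat),
        MulAut.conj γ • Λ.map ((T.qhat j).comp D.ιX) ≤ MulAut.conj g • ((Dd j).vertGp v).map (T.Q j).ι →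
        MulAut.conj γ • Λ.map ((T.qhat j).comp D.ιX) ≤ MulAut.conj h • ((Dd j).vertGp w).map (T.Q j).ι →
          (v = w ∧ g⁻¹ * h ∈ ((Dd j).vertGp v).map (T.Q j).ι) ∨
          (∃ (e : E j) (k : (T.Q j).Hat), ∃ p ∈ ((Dd j).vertGp (src j e)).map (T.Q j).ι,
            ∃ q ∈ ((Dd j).vertGp (tgt j e)).map (T.Q j).ι,
            (src j e = v ∧ tgt j e = w ∧ g = k * (T.Q j).ι (c₁ j e) * p ∧ h = k * (T.Q j).ι (c₂ j e) * q) ∨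
            (src j e = w ∧ tgt j e = v ∧ h = k * (T.Q j).ι (c₁ j e) * p ∧ g = k * (T.Q j).ι (c₂ j e) * q)) ∨
          (∃ (u : V j) (f : (T.Q j).Hat),
            (∃ (e : E j) (k : (T.Q j).Hat), ∃ p ∈ ((Dd j).vertGp (src j e)).map (T.Q j).ι,
              ∃ q ∈ ((Dd j).vertGp (tgt j e)).map (T.Q j).ι,
              (src j e = v ∧ tgt j e = u ∧ g = k * (T.Q j).ι (c₁ j e) * p ∧ f = k * (T.Q j).ι (c₂ j e) * q) ∨
              (src j e = u ∧ tgt j e = v ∧ f = k * (T.Q j).ι (c₁ j e) * p ∧ g = k * (T.Q j).ι (c₂ j e) * q)) ∧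
            (∃ (e : E j) (k : (T.Q j).Hat), ∃ p ∈ ((Dd j).vertGp (src j e)).map (T.Q j).ι,
              ∃ q ∈ ((Dd j).vertGp (tgt j e)).map (T.Q j).ι,
              (src j e = u ∧ tgt j e = w ∧ f = k * (T.Q j).ι (c₁ j e) * p ∧ h = k * (T.Q j).ι (c₂ j e) * q) ∨
              (src j e = w ∧ tgt j e = u ∧ h = k * (T.Q j).ι (c₁ j e) * p ∧ f = k * (T.Q j).ι (c₂ j e) * q)))) :
    T.LevelObservation := by
  refine T.levelObservation_of_cosetTrees (fun j v => ((Dd j).vertGp v).map (T.Q j).ι)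
    (fun j v => Subgroup.map_le_range _ _) src tgt c₁ c₂ ?_ hA3
  -- (A1-arith) in coordinates from `ArithMaximalCompactStatementI` + `hK`
  intro j Λ hΛc hΛne hΛo γ hγ
  obtain ⟨hKc, hKa⟩ := hK j Λ hΛc hΛne hΛo γ hγ
  obtain ⟨⟨W, ⟨v, g', rfl⟩, hKW⟩, -⟩ := hI j _ hKc hKa
  refine ⟨v, (T.Q j).ι g', ⟨g', rfl⟩, ?_⟩
  rw [← Subgroup.map_comap_eq_self hγ]
  exact (Subgroup.map_mono hKW).trans (map_conjSubgroup_le _ _ _)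

end Prop24QTower

/-! ### At the genuine 𝔛-datum -/

namespace OfSpecialFibre

open Literature.AnabelianGeometry.SemiGraphs.ProfiniteSemiGraph

variable {p : ℕ} [Fact p.Prime] (X : TemperedCurve p) (T : SpecialFibreTower X.DeltaTemp) (d : X.GroupLevelData)
  (S : SpecialFibreData (X.toTemperedArithmeticGroup d)) (h36 : S.Gc.Prop36Hypotheses)
  (Sigma SigmaHat : Set ℕ) (hsub : Sigma ⊆ SigmaHat) (hne : Set.Nonempty Sigma)
  (hprime : ∀ q ∈ SigmaHat, q.Prime) (hp : p ∉ Sigma) (TpH : Subgroup S.chart.G)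
  (HatH : Subgroup (TemperedGraphGroupData.exists_completion_of_prop36 S.Gc h36 S.chart).choose)
  (hle : TpH.map (TemperedGraphGroupData.exists_completion_of_prop36 S.Gc h36
    S.chart).choose_spec.choose.toMonoidHom ≤ HatH)
  (cuspMeetsH : {x : X.Pt // X.IsCusp x} → Prop)

/-- **[IUTchI] Prop. 2.4 (ii) AS TYPED at the genuine 𝔛-datum over `P`, "this observation" keyed on [SemiAnbd]
Thm. 5.4 (i) AS TYPED by abc-iut-L3** — abc-iut-w4-d063's `prop24ii_ofPiData (P) (hadm) (hLev)` with `hLev :=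
levelObservation_of_arithStatementI …` for the genuine quotient tower (levels `Π^temp_{X_K} ⧸ admKer_j ↪
Π_{X_K} ⧸ closure ι(admKer_j)`).  Laws: `hadm`; per level `hI` (L3's `ArithMaximalCompactStatementI`), `hK`
(pull-back law), (A3-arith); data: per-level `DecompositionData`, augmentations, node/branch data.
([IUTchI] Prop 2.4(ii) pp.50-51) [claim: Mochizuki2012, status: disputed] -/
theorem prop24ii_ofPiData_of_arithStatementI (P : SpecialFibreTower.PiData X d S T)
    (hadm : ∀ U ∈ 𝓝 (1 : ↥X.DeltaTemp), ∃ j, ((T.admKer j : Subgroup ↥X.DeltaTemp) : Set ↥X.DeltaTemp) ⊆ U)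
    {V B : ℕ → Type*}
    (Dd : ∀ j, DecompositionData ((qTowerOfSpecialFibreTower X T d S h36 Sigma SigmaHat hsub hne hprime hp TpH HatH hle cuspMeetsH P.admKer_normal_pi).Q j).Tp (V j) (B j))
    {PA : ℕ → Type*} [∀ j, Group (PA j)] [∀ j, TopologicalSpace (PA j)]
    (augTp : ∀ j, ((qTowerOfSpecialFibreTower X T d S h36 Sigma SigmaHat hsub hne hprime hp TpH HatH hle cuspMeetsH P.admKer_normal_pi).Q j).Tp →* PA j)
    (hI : ∀ j, ArithMaximalCompactStatementI (Dd j) (augTp j))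
    (hK : ∀ (j : ℕ) (Λ : Subgroup X.PiTemp), IsCompact (Λ : Set X.PiTemp) → Λ ≠ ⊥ →
      IsOpen (Λ.map X.augGK.toMonoidHom : Set X.GK) →
      ∀ γ : ((qTowerOfSpecialFibreTower X T d S h36 Sigma SigmaHat hsub hne hprime hp TpH HatH hle cuspMeetsH P.admKer_normal_pi).Q j).Hat,
        MulAut.conj γ • Λ.map (((qTowerOfSpecialFibreTower X T d S h36 Sigma SigmaHat hsub hne hprime hp TpH HatH hle cuspMeetsH P.admKer_normal_pi).qhat j).comp X.toHat.toMonoidHom) ≤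
          ((qTowerOfSpecialFibreTower X T d S h36 Sigma SigmaHat hsub hne hprime hp TpH HatH hle cuspMeetsH P.admKer_normal_pi).Q j).ι.range →
          IsCompact ((((MulAut.conj γ • Λ.map (((qTowerOfSpecialFibreTower X T d S h36 Sigma SigmaHat hsub hne hprime hp TpH HatH hle cuspMeetsH P.admKer_normal_pi).qhat j).comp X.toHat.toMonoidHom)).comap
              ((qTowerOfSpecialFibreTower X T d S h36 Sigma SigmaHat hsub hne hprime hp TpH HatH hle cuspMeetsH P.admKer_normal_pi).Q j).ι :
              Subgroup ((qTowerOfSpecialFibreTower X T d S h36 Sigma SigmaHat hsub hne hprime hp TpH HatH hle cuspMeetsH P.admKer_normal_pi).Q j).Tp)) :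
              Set ((qTowerOfSpecialFibreTower X T d S h36 Sigma SigmaHat hsub hne hprime hp TpH HatH hle cuspMeetsH P.admKer_normal_pi).Q j).Tp) ∧
          IsArithAmple (augTp j) ((MulAut.conj γ • Λ.map (((qTowerOfSpecialFibreTower X T d S h36 Sigma SigmaHat hsub hne hprime hp TpH HatH hle cuspMeetsH P.admKer_normal_pi).qhat j).comp X.toHat.toMonoidHom)).comap
              ((qTowerOfSpecialFibreTower X T d S h36 Sigma SigmaHat hsub hne hprime hp TpH HatH hle cuspMeetsH P.admKer_normal_pi).Q j).ι))
    {E : ℕ → Type*} (src tgt : ∀ j, E j → V j)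
    (c₁ c₂ : ∀ j, E j → ((qTowerOfSpecialFibreTower X T d S h36 Sigma SigmaHat hsub hne hprime hp TpH HatH hle cuspMeetsH P.admKer_normal_pi).Q j).Tp)
    (hA3 : ∀ (j : ℕ) (Λ : Subgroup X.PiTemp), IsCompact (Λ : Set X.PiTemp) → Λ ≠ ⊥ →
      IsOpen (Λ.map X.augGK.toMonoidHom : Set X.GK) →
      ∀ (v w : V j) (g h γ : ((qTowerOfSpecialFibreTower X T d S h36 Sigma SigmaHat hsub hne hprime hp TpH HatH hle cuspMeetsH P.admKer_normal_pi).Q j).Hat),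
        MulAut.conj γ • Λ.map (((qTowerOfSpecialFibreTower X T d S h36 Sigma SigmaHat hsub hne hprime hp TpH HatH hle cuspMeetsH P.admKer_normal_pi).qhat j).comp X.toHat.toMonoidHom) ≤
            MulAut.conj g • ((Dd j).vertGp v).map ((qTowerOfSpecialFibreTower X T d S h36 Sigma SigmaHat hsub hne hprime hp TpH HatH hle cuspMeetsH P.admKer_normal_pi).Q j).ι →
        MulAut.conj γ • Λ.map (((qTowerOfSpecialFibreTower X T d S h36 Sigma SigmaHat hsub hne hprime hp TpH HatH hle cuspMeetsH P.admKer_normal_pi).qhat j).comp X.toHat.toMonoidHom) ≤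
            MulAut.conj h • ((Dd j).vertGp w).map ((qTowerOfSpecialFibreTower X T d S h36 Sigma SigmaHat hsub hne hprime hp TpH HatH hle cuspMeetsH P.admKer_normal_pi).Q j).ι →
          (v = w ∧ g⁻¹ * h ∈ ((Dd j).vertGp v).map ((qTowerOfSpecialFibreTower X T d S h36 Sigma SigmaHat hsub hne hprime hp TpH HatH hle cuspMeetsH P.admKer_normal_pi).Q j).ι) ∨
          (∃ (e : E j) (k : ((qTowerOfSpecialFibreTower X T d S h36 Sigma SigmaHat hsub hne hprime hp TpH HatH hle cuspMeetsH P.admKer_normal_pi).Q j).Hat),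
            ∃ p ∈ ((Dd j).vertGp (src j e)).map ((qTowerOfSpecialFibreTower X T d S h36 Sigma SigmaHat hsub hne hprime hp TpH HatH hle cuspMeetsH P.admKer_normal_pi).Q j).ι,
            ∃ q ∈ ((Dd j).vertGp (tgt j e)).map ((qTowerOfSpecialFibreTower X T d S h36 Sigma SigmaHat hsub hne hprime hp TpH HatH hle cuspMeetsH P.admKer_normal_pi).Q j).ι,
            (src j e = v ∧ tgt j e = w ∧
                g = k * ((qTowerOfSpecialFibreTower X T d S h36 Sigma SigmaHat hsub hne hprime hp TpH HatH hle cuspMeetsH P.admKer_normal_pi).Q j).ι (c₁ j e) * p ∧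
                h = k * ((qTowerOfSpecialFibreTower X T d S h36 Sigma SigmaHat hsub hne hprime hp TpH HatH hle cuspMeetsH P.admKer_normal_pi).Q j).ι (c₂ j e) * q) ∨
            (src j e = w ∧ tgt j e = v ∧
                h = k * ((qTowerOfSpecialFibreTower X T d S h36 Sigma SigmaHat hsub hne hprime hp TpH HatH hle cuspMeetsH P.admKer_normal_pi).Q j).ι (c₁ j e) * p ∧
                g = k * ((qTowerOfSpecialFibreTower X T d S h36 Sigma SigmaHat hsub hne hprime hp TpH HatH hle cuspMeetsH P.admKer_normal_pi).Q j).ι (c₂ j e) * q)) ∨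
          (∃ (u : V j) (f : ((qTowerOfSpecialFibreTower X T d S h36 Sigma SigmaHat hsub hne hprime hp TpH HatH hle cuspMeetsH P.admKer_normal_pi).Q j).Hat),
            (∃ (e : E j) (k : ((qTowerOfSpecialFibreTower X T d S h36 Sigma SigmaHat hsub hne hprime hp TpH HatH hle cuspMeetsH P.admKer_normal_pi).Q j).Hat),
              ∃ p ∈ ((Dd j).vertGp (src j e)).map ((qTowerOfSpecialFibreTower X T d S h36 Sigma SigmaHat hsub hne hprime hp TpH HatH hle cuspMeetsH P.admKer_normal_pi).Q j).ι,
              ∃ q ∈ ((Dd j).vertGp (tgt j e)).map ((qTowerOfSpecialFibreTower X T d S h36 Sigma SigmaHat hsub hne hprime hp TpH HatH hle cuspMeetsH P.admKer_normal_pi).Q j).ι,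
              (src j e = v ∧ tgt j e = u ∧
                  g = k * ((qTowerOfSpecialFibreTower X T d S h36 Sigma SigmaHat hsub hne hprime hp TpH HatH hle cuspMeetsH P.admKer_normal_pi).Q j).ι (c₁ j e) * p ∧
                  f = k * ((qTowerOfSpecialFibreTower X T d S h36 Sigma SigmaHat hsub hne hprime hp TpH HatH hle cuspMeetsH P.admKer_normal_pi).Q j).ι (c₂ j e) * q) ∨
              (src j e = u ∧ tgt j e = v ∧
                  f = k * ((qTowerOfSpecialFibreTower X T d S h36 Sigma SigmaHat hsub hne hprime hp TpH HatH hle cuspMeetsH P.admKer_normal_pi).Q j).ι (c₁ j e) * p ∧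
                  g = k * ((qTowerOfSpecialFibreTower X T d S h36 Sigma SigmaHat hsub hne hprime hp TpH HatH hle cuspMeetsH P.admKer_normal_pi).Q j).ι (c₂ j e) * q)) ∧
            (∃ (e : E j) (k : ((qTowerOfSpecialFibreTower X T d S h36 Sigma SigmaHat hsub hne hprime hp TpH HatH hle cuspMeetsH P.admKer_normal_pi).Q j).Hat),
              ∃ p ∈ ((Dd j).vertGp (src j e)).map ((qTowerOfSpecialFibreTower X T d S h36 Sigma SigmaHat hsub hne hprime hp TpH HatH hle cuspMeetsH P.admKer_normal_pi).Q j).ι,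
              ∃ q ∈ ((Dd j).vertGp (tgt j e)).map ((qTowerOfSpecialFibreTower X T d S h36 Sigma SigmaHat hsub hne hprime hp TpH HatH hle cuspMeetsH P.admKer_normal_pi).Q j).ι,
              (src j e = u ∧ tgt j e = w ∧
                  f = k * ((qTowerOfSpecialFibreTower X T d S h36 Sigma SigmaHat hsub hne hprime hp TpH HatH hle cuspMeetsH P.admKer_normal_pi).Q j).ι (c₁ j e) * p ∧
                  h = k * ((qTowerOfSpecialFibreTower X T d S h36 Sigma SigmaHat hsub hne hprime hp TpH HatH hle cuspMeetsH P.admKer_normal_pi).Q j).ι (c₂ j e) * q) ∨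
              (src j e = w ∧ tgt j e = u ∧
                  h = k * ((qTowerOfSpecialFibreTower X T d S h36 Sigma SigmaHat hsub hne hprime hp TpH HatH hle cuspMeetsH P.admKer_normal_pi).Q j).ι (c₁ j e) * p ∧
                  f = k * ((qTowerOfSpecialFibreTower X T d S h36 Sigma SigmaHat hsub hne hprime hp TpH HatH hle cuspMeetsH P.admKer_normal_pi).Q j).ι (c₂ j e) * q)))) :
    (ofSpecialFibre X d S h36 Sigma SigmaHat hsub hne hprime hp TpH HatH hle cuspMeetsH).Prop24ii :=
  prop24ii_ofPiData X T d S h36 Sigma SigmaHat hsub hne hprime hp TpH HatH hle cuspMeetsH P hadm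
    (Prop24QTower.levelObservation_of_arithStatementI _ Dd augTp hI hK src tgt c₁ c₂ hA3)

end OfSpecialFibre

end StableCurveTemperedData

end Literature.IUT.HodgeTheaters

end
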